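import Literature.MathematicalPhysics.QuantumManyBody.PeriodicBoseGas
import Mathlib.Analysis.SpecialFunctions.Pow.Real
import Mathlib.Analysis.Calculus.FDeriv.Basic
import HarnessLib

/-!
# Locality-graded, power-weighted many-body kernel norms

Topic `Literature/MathematicalPhysics/QuantumManyBody` (definition item `defn-KernelNorm`, posited by
the idea card `policy-iteration-newton-riccati` / route BECPolicyIteration of the summit
`AtomisticToContinuum`, sub-problem `BoseEinsteinCondensation`, for the informal crux
`TameNewtonScheme`: a Nash–Moser / policy-iteration scheme for `S = -log Ψ₀` on the torus needs a
graded family of norms on symmetric functions *presented* as sums of `k`-body kernels).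

Everything lives on the flat torus `ℝ³/Lℤ³` of `PeriodicBoseGas.lean` (`Space = ℝ³`,
`Config N = (ℝ³)^N`, `latticeVec L n = L n`), modelled as `Lℤ³`-periodic objects on `ℝ³`.

* `torusDist L x y = inf_{n ∈ ℤ³} |x - y - L n|` — the flat-torus distance.
* **Kernel families.** A family of many-body kernels is `u : (k : ℕ) → Config (k + 1) → E`,
  the kernel `u k` having ARITY `k + 1` (so `u 0` is the one-body term, `u 1` the pair kernel, …;
  indexing by `arity - 1` keeps every arity positive and makes the activity weight below `λ^k`).
  `IsKernelFamily L u`: every `u k` is permutation-symmetric, `Lℤ³`-periodic in each particle and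
  invariant under simultaneous translation of all particles.
* **Presentations.** `presented u N X = ∑_{∅ ≠ s ⊆ Fin N} u_{|s|-1}(X|_s)` — the symmetric
  `N`-body function `S = ∑_{k ≥ 1} ∑_{i₁ < ⋯ < i_k} u_k(x_{i₁}, …, x_{i_k})` presented by the family
  (`X|_s` lists the particles of `s` in increasing order; `atArity u m` is the arity-`m` kernel,
  `0` for `m = 0`). `Presents L u N S`: `u` is an admissible family presenting `S`. The
  presentation is DATA: `S` does not determine `u` (constants can be shifted between arities), and
  the norms below are norms of `u`, not of `S`.
* **Tree weights.** For `X = (x₀, …, x_k) ∈ Config (k + 1)` and `1 ≤ j ≤ k`,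
  `treeDist L X (j-1) = min_{i < j} d_L(x_j, x_i)` is the torus distance from `x_j` to the nearest
  of the PRECEDING particles `x₀, …, x_{j-1}`; the edges `(x_j, nearest predecessor)` form a
  spanning tree of the configuration rooted at `x₀` (the insertion tree of cluster-expansion
  tree-graph bounds), and `∑_j treeDist` dominates the Steiner / minimal-spanning-tree length.
  `treeWeight p ℓ L X = ∏_{j=1}^{k} (1 + treeDist L X (j-1) / ℓ) ^ p` — POWER weights with decay
  exponent `p` at locality scale `ℓ` (algebraic, not exponential: the two-body part of `log Ψ₀`
  has the Reatto–Chester tail `u₂ ≍ r⁻²`, `∇u₂ ≍ r⁻³` [ReattoChester1967], whose weighted sup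
  `sup_r (1 + r/ℓ)^p r^{-2}` is finite uniformly in `L` iff `p ≤ 2` (resp. `p ≤ 3` for the
  gradient), whereas any `L¹`-in-one-variable norm `∫_{|y| < L} r⁻² d³y ≍ L` diverges with the
  volume).
* **The norms.** `weightedSup p ℓ L f = sup_X treeWeight(X) ‖f X‖` (an `ℝ≥0∞`-valued weighted sup
  norm of one kernel: `sup_{x₀} sup_{x₁ … x_k}`), and for an activity `λ = z ≥ 0`
  `kernelNorm L p z ℓ u = ∑_k z^k · weightedSup p ℓ L (u k)   (= ∑_{arity a ≥ 1} λ^{a-1} sup Π(1+d_T/ℓ)^p |u_a|)`,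
  `gradKernelNorm L p z ℓ u = kernelNorm L p z ℓ (k ↦ X ↦ fderiv ℝ (u k) X)` (the same norm of the
  family of total derivatives, measured in the operator norm of `Config (k+1) →L[ℝ] ℝ`, i.e.
  `∑_j |∇_{x_j} u_k|` for the sup norm on `(ℝ³)^{k+1}`). The family `ℓ ↦ kernelNorm L p z ℓ` is the
  locality GRADING: the norms decrease as `ℓ` increases (`kernelNorm_anti_scale`), and
  `1 ≤ treeWeight` (`one_le_treeWeight`) so every norm dominates the plain activity-weighted sup
  norm (`nnnorm_le_weightedSup`).

## Why these choices (and what is claimed only informally)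

* *Tame product.* If `u` has arity `k + 1` and `u'` arity `k' + 1` and they share exactly one
  particle, their product is a kernel of arity `k + k' + 1`, with activity weight
  `z^{k+k'} = z^k z^{k'}`; and for tree weights rooted at the shared particle the weight of the
  merged configuration is at most the product of the two weights (a predecessor set only grows,
  so nearest-predecessor distances only shrink). Re-rooting / re-ordering a configuration changes
  `treeWeight` by at most a factor depending on `p` and the arity (all insertion trees are
  comparable to the minimal spanning tree), which is why the ORDER-DEPENDENT insertion tree can be
  used with symmetric kernels: for symmetric `f`, `weightedSup` is the sup against the maximum of
  `treeWeight` over orderings. These comparabilities are the content of the route's "tame product"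
  estimate `‖ |∇S|² ‖ ≤ C ‖∇u‖²` and are NOT proved here.
* *Sup norms, pointwise.* `weightedSup` is a supremum over all of `(ℝ³)^{k+1}` (for periodic,
  translation-invariant kernels this equals the sup over `x₀ = 0`, `x_j` in a fundamental cell);
  no measure, no essential sup: the kernels of the scheme are `C¹`. `fderiv` is `0` where `u k` is
  not differentiable (Mathlib's junk value), so `gradKernelNorm` is meaningful for `C¹` kernels.
* *Junk values.* All norms are `ℝ≥0∞`-valued (`⊤` = infinite norm; no summability side
  conditions). They are intended for `0 < ℓ`, `0 ≤ p`, `0 < L`; for `ℓ ≤ 0` the real power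
  `(1 + d/ℓ)^p` is Mathlib's junk `rpow` of a possibly negative base. `torusDist 0 = dist`.
* *Nearest printed analogues* (no source states this object; the combination — sup norms,
  POWER tree weights, a locality scale `ℓ` — is the route's): for quantum LATTICE systems the
  many-body coefficients `g(X)`, `X ⊂ Λ`, of `-log Ψ₀` are normed by
  `‖χ‖ = ∑_A |χ(A)|` (the `ℓ¹` norm of the coefficients of the one-site functions `φ_Λ(i, ·)`,
  locality measured separately by the "range") in Kirkwood–Thomas, §2, (2.4) and Thm. 2.1, and
  by `‖g‖ = ∑_{X ∋ i} |g(X)| θ^{-w(X)}` with `w(X)` = the number of bonds of the smallest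
  connected set of bonds containing `X` (a Steiner-tree weight, exponential in `w`, `θ < 1` a
  constant; `sup_i` without translation invariance) in Datta–Kennedy, §2, the norm before Thm. 1
  (and `w₀(X)`, rooted at the origin, in §3); the lattice form of the tame-product mechanism is
  their claim `w(X₁ Δ ⋯ Δ X_n) ≤ ∑_j w(X_j)` for sets sharing a site (proof of Thm. 1). The present
  norms are the continuum analogue with polynomial instead of exponential tree weights and a sup
  instead of a sum over the other particles. Mathlib has no
  many-body kernels, torus distance on `EuclideanSpace`, or tree weights (searched `torusDist`,
  `treeWeight`, `kernelNorm`, `Steiner`); `Finset.orderEmbOfFin`, `Finset.inf'`, `Real.rpow`,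
  `fderiv`, `tsum` are Mathlib's.

## References

* [ReattoChester1967] L. Reatto, G. V. Chester, *Phonons and the properties of a Bose system*,
  Phys. Rev. 155 (1967) 88–100 (the `r⁻²` tail of the optimal Jastrow pair function).
* [KirkwoodThomas1983] J. R. Kirkwood, L. E. Thomas, *Expansions and phase transitions for the
  ground state of quantum Ising lattice systems*, Comm. Math. Phys. 88 (1983) 569–580: §2, (2.1)–(2.4)
  and Thm. 2.1 (p. 572).
* [DattaKennedy2002] N. Datta, T. Kennedy, *Expansions for one quasiparticle states in spin 1/2
  systems*, J. Stat. Phys. 108 (2002) 373–399 (arXiv:cond-mat/0104199): §2 (the norm `‖g‖` and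
  Thm. 1), §3 (the norm `‖e‖` with `w₀`).
-/

noncomputable section

open scoped ENNReal NNReal

namespace Literature.MathematicalPhysics.QuantumManyBody.BoseGas

/-! ### The flat-torus distance -/

/-- The distance `d_L(x, y) = inf_{n ∈ ℤ³} |x - (y + L n)|` between the classes of `x, y ∈ ℝ³` on
the flat torus `ℝ³/Lℤ³` (for `L = 0` it is the Euclidean distance). [folklore] -/
def torusDist (L : ℝ) (x y : Space) : ℝ :=
  ⨅ n : Fin 3 → ℤ, dist x (y + latticeVec L n)

/-- The distances to the lattice translates are bounded below (by `0`). [folklore] -/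
theorem bddBelow_range_dist_add_latticeVec (L : ℝ) (x y : Space) :
    BddBelow (Set.range fun n : Fin 3 → ℤ => dist x (y + latticeVec L n)) :=
  ⟨0, by rintro _ ⟨n, rfl⟩; exact dist_nonneg⟩

/-- `0 ≤ d_L(x, y)`. [folklore] -/
theorem torusDist_nonneg (L : ℝ) (x y : Space) : 0 ≤ torusDist L x y :=
  Real.iInf_nonneg fun _ => dist_nonneg

/-- `d_L(x, y) ≤ |x - (y + Ln)|` for every lattice translate. [folklore] -/
theorem torusDist_le_dist_add_latticeVec (L : ℝ) (x y : Space) (n : Fin 3 → ℤ) :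
    torusDist L x y ≤ dist x (y + latticeVec L n) :=
  ciInf_le (bddBelow_range_dist_add_latticeVec L x y) n

/-- `d_L(x, y) ≤ |x - y|`. [folklore] -/
theorem torusDist_le_dist (L : ℝ) (x y : Space) : torusDist L x y ≤ dist x y := by
  simpa [latticeVec_zero] using torusDist_le_dist_add_latticeVec L x y 0

/-- `d_L(x, x) = 0`. [folklore] -/
theorem torusDist_self (L : ℝ) (x : Space) : torusDist L x x = 0 :=
  le_antisymm (by simpa using torusDist_le_dist L x x) (torusDist_nonneg L x x)

/-- `d_L` is symmetric. [folklore] -/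
theorem torusDist_comm (L : ℝ) (x y : Space) : torusDist L x y = torusDist L y x := by
  unfold torusDist
  refine Equiv.iInf_congr (Equiv.neg (Fin 3 → ℤ)) fun n => ?_
  have hneg : latticeVec L (-n) = -latticeVec L n := by
    ext k; simp [latticeVec]
  rw [Equiv.neg_apply, hneg, dist_eq_norm, dist_eq_norm, ← norm_neg]
  congr 1
  abel

/-- `d_L` is invariant under lattice translation of the second argument. [folklore] -/
theorem torusDist_add_latticeVec (L : ℝ) (x y : Space) (m : Fin 3 → ℤ) :
    torusDist L x (y + latticeVec L m) = torusDist L x y := by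
  unfold torusDist
  refine Equiv.iInf_congr (Equiv.addLeft m) fun n => ?_
  have hadd : latticeVec L (m + n) = latticeVec L m + latticeVec L n := by
    ext k; simp [latticeVec, mul_add]
  show dist x (y + latticeVec L (m + n)) = dist x (y + latticeVec L m + latticeVec L n)
  rw [hadd, add_assoc]

/-! ### Kernel families and presentations -/

section Presentation

variable {E : Type*} [AddCommMonoid E]

/-- The arity-`m` kernel of a family `u` (`u k` has arity `k + 1`); the arity-`0` kernel is `0`.
[folklore] -/
def atArity (u : (k : ℕ) → Config (k + 1) → E) : (m : ℕ) → Config m → E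
  | 0 => fun _ => 0
  | k + 1 => u k

/-- The arity-`0` kernel is `0`. [folklore] -/
@[simp] theorem atArity_zero (u : (k : ℕ) → Config (k + 1) → E) (X : Config 0) :
    atArity u 0 X = 0 := rfl

/-- The arity-`(k+1)` kernel is `u k`. [folklore] -/
@[simp] theorem atArity_succ (u : (k : ℕ) → Config (k + 1) → E) (k : ℕ) :
    atArity u (k + 1) = u k := rfl

/-- The `N`-body function PRESENTED by the kernel family `u`:
`S(X) = ∑_{k ≥ 1} ∑_{i₁ < ⋯ < i_k} u_k(x_{i₁}, …, x_{i_k}) = ∑_{∅ ≠ s ⊆ {0,…,N-1}} u_{|s|-1}(X|_s)`,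
where `X|_s = X ∘ s.orderEmbOfFin` lists the particles of `s` in increasing order (the empty set
contributes `atArity u 0 = 0`). [folklore] -/
def presented (u : (k : ℕ) → Config (k + 1) → E) (N : ℕ) (X : Config N) : E :=
  ∑ s : Finset (Fin N), atArity u s.card fun i => X (s.orderEmbOfFin rfl i)

/-- Every kernel of the zero family is `0`. [folklore] -/
@[simp] theorem atArity_zero_family (m : ℕ) :
    atArity (0 : (k : ℕ) → Config (k + 1) → E) m = 0 := by
  cases m <;> rfl

/-- The zero family presents the zero function. [folklore] -/
@[simp] theorem presented_zero (N : ℕ) :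
    presented (0 : (k : ℕ) → Config (k + 1) → E) N = 0 := by
  funext X
  simp [presented]

end Presentation

/-- Admissible kernel families on the torus of side `L`: every kernel `u k` (arity `k + 1`) is
symmetric under permutations of its particles, `Lℤ³`-periodic in each particle (stated on the
generators `L e_c`, as `PeriodicTrialState.periodic`) and invariant under simultaneous
translation of all its particles. [folklore] -/
structure IsKernelFamily (L : ℝ) (u : (k : ℕ) → Config (k + 1) → ℝ) : Prop where
  /-- `u_k(x_{σ 0}, …, x_{σ k}) = u_k(x₀, …, x_k)`. -/
  symm : ∀ (k : ℕ) (σ : Equiv.Perm (Fin (k + 1))) (X : Config (k + 1)), u k (X ∘ σ) = u k X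
  /-- `u_k(…, x_i + L e_c, …) = u_k(…, x_i, …)`. -/
  periodic : ∀ (k : ℕ) (X : Config (k + 1)) (i : Fin (k + 1)) (c : Fin 3),
    u k (X + Pi.single i (EuclideanSpace.single c L)) = u k X
  /-- `u_k(x₀ + a, …, x_k + a) = u_k(x₀, …, x_k)`. -/
  transl : ∀ (k : ℕ) (X : Config (k + 1)) (a : Space), u k (fun i => X i + a) = u k X

/-- The zero family is admissible. [folklore] -/
theorem IsKernelFamily.zero (L : ℝ) : IsKernelFamily L 0 where
  symm _ _ _ := rfl
  periodic _ _ _ _ := rfl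
  transl _ _ _ := rfl

/-- `u` is a PRESENTATION of the `N`-body function `S` on the torus of side `L`: an admissible
kernel family with `presented u N = S`. [folklore] -/
def Presents (L : ℝ) (u : (k : ℕ) → Config (k + 1) → ℝ) (N : ℕ) (S : Config N → ℝ) : Prop :=
  IsKernelFamily L u ∧ presented u N = S

/-- The zero family presents `0`. [folklore] -/
theorem Presents.zero (L : ℝ) (N : ℕ) : Presents L 0 N 0 :=
  ⟨IsKernelFamily.zero L, presented_zero N⟩

/-! ### Tree distances and power weights -/

section Weights

variable {k : ℕ}

/-- The insertion-tree distance of particle `j + 1` of `X = (x₀, …, x_k)`: the torus distance from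
`x_{j+1}` to the nearest of the preceding particles `x₀, …, x_j` (`j : Fin k`, so `j + 1` ranges
over `1, …, k`; the root `x₀` has no factor). [folklore] -/
def treeDist (L : ℝ) (X : Config (k + 1)) (j : Fin k) : ℝ :=
  (Finset.Iic j).inf' Finset.nonempty_Iic fun i => torusDist L (X j.succ) (X (Fin.castSucc i))

/-- `treeDist ≤` the distance to any particular predecessor. [folklore] -/
theorem treeDist_le (L : ℝ) (X : Config (k + 1)) {i j : Fin k} (h : i ≤ j) :
    treeDist L X j ≤ torusDist L (X j.succ) (X (Fin.castSucc i)) :=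
  Finset.inf'_le _ (Finset.mem_Iic.2 h)

/-- `0 ≤ treeDist`. [folklore] -/
theorem treeDist_nonneg (L : ℝ) (X : Config (k + 1)) (j : Fin k) : 0 ≤ treeDist L X j :=
  Finset.le_inf' _ _ fun _ _ => torusDist_nonneg L _ _

/-- For a two-body configuration the only tree distance is `d_L(x₁, x₀)`. [folklore] -/
theorem treeDist_two (L : ℝ) (X : Config (1 + 1)) (j : Fin 1) :
    treeDist L X j = torusDist L (X 1) (X 0) := by
  obtain rfl : j = 0 := Subsingleton.elim _ _
  have h1 : ((0 : Fin 1).succ : Fin (1 + 1)) = 1 := rfl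
  have h0 : (Fin.castSucc (0 : Fin 1) : Fin (1 + 1)) = 0 := rfl
  refine le_antisymm ((treeDist_le L X (i := 0) (j := 0) le_rfl).trans_eq ?_)
    (Finset.le_inf' _ _ fun i _ => ?_)
  · rw [h1, h0]
  · obtain rfl : i = 0 := Subsingleton.elim _ _
    rw [h1, h0]

/-- The POWER TREE WEIGHT `∏_{j=1}^{k} (1 + treeDist_j / ℓ) ^ p` of a configuration of arity
`k + 1`, with decay exponent `p` and locality scale `ℓ` (empty product `= 1` for arity `1`).
[folklore] -/
def treeWeight (p ℓ L : ℝ) (X : Config (k + 1)) : ℝ :=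
  ∏ j : Fin k, (1 + treeDist L X j / ℓ) ^ p

/-- Each factor of the tree weight is `≥ 1` (for `0 ≤ p`, `0 < ℓ`). [folklore] -/
theorem one_le_treeWeight_factor {p ℓ : ℝ} (hp : 0 ≤ p) (hℓ : 0 < ℓ) (L : ℝ) (X : Config (k + 1))
    (j : Fin k) : 1 ≤ (1 + treeDist L X j / ℓ) ^ p :=
  Real.one_le_rpow (le_add_of_nonneg_right (div_nonneg (treeDist_nonneg L X j) hℓ.le)) hp

/-- `1 ≤ treeWeight` (for `0 ≤ p`, `0 < ℓ`). [folklore] -/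
theorem one_le_treeWeight {p ℓ : ℝ} (hp : 0 ≤ p) (hℓ : 0 < ℓ) (L : ℝ) (X : Config (k + 1)) :
    1 ≤ treeWeight p ℓ L X := by
  unfold treeWeight
  calc (1 : ℝ) = ∏ _j : Fin k, (1 : ℝ) := by simp
    _ ≤ ∏ j : Fin k, (1 + treeDist L X j / ℓ) ^ p :=
      Finset.prod_le_prod (fun _ _ => zero_le_one) fun j _ => one_le_treeWeight_factor hp hℓ L X j

/-- `0 ≤ treeWeight` (for `0 < ℓ`). [folklore] -/
theorem treeWeight_nonneg (p : ℝ) {ℓ : ℝ} (hℓ : 0 < ℓ) (L : ℝ) (X : Config (k + 1)) :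
    0 ≤ treeWeight p ℓ L X :=
  Finset.prod_nonneg fun j _ =>
    Real.rpow_nonneg (add_nonneg zero_le_one (div_nonneg (treeDist_nonneg L X j) hℓ.le)) _

/-- One-body kernels carry no weight: `treeWeight = 1` in arity `1`. [folklore] -/
@[simp] theorem treeWeight_one (p ℓ L : ℝ) (X : Config (0 + 1)) : treeWeight p ℓ L X = 1 := by
  simp [treeWeight]

/-- The two-body weight is `(1 + d_L(x₁, x₀)/ℓ) ^ p`. [folklore] -/
theorem treeWeight_two (p ℓ L : ℝ) (X : Config (1 + 1)) :
    treeWeight p ℓ L X = (1 + torusDist L (X 1) (X 0) / ℓ) ^ p := by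
  simp [treeWeight, treeDist_two]

/-- The tree weight decreases as the locality scale grows (`0 ≤ p`, `0 < ℓ ≤ ℓ'`). [folklore] -/
theorem treeWeight_anti_scale {p ℓ ℓ' : ℝ} (hp : 0 ≤ p) (hℓ : 0 < ℓ) (h : ℓ ≤ ℓ') (L : ℝ)
    (X : Config (k + 1)) : treeWeight p ℓ' L X ≤ treeWeight p ℓ L X := by
  have hℓ' : 0 < ℓ' := hℓ.trans_le h
  unfold treeWeight
  refine Finset.prod_le_prod (fun j _ => ?_) fun j _ => ?_
  · exact Real.rpow_nonneg (add_nonneg zero_le_one (div_nonneg (treeDist_nonneg L X j) hℓ'.le)) _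
  · have hd := treeDist_nonneg L X j
    refine Real.rpow_le_rpow (add_nonneg zero_le_one (div_nonneg hd hℓ'.le)) ?_ hp
    have := div_le_div_of_nonneg_left hd hℓ h
    linarith

/-- The tree weight increases with the decay exponent (`p ≤ p'`, `0 < ℓ`). [folklore] -/
theorem treeWeight_mono_exponent {p p' ℓ : ℝ} (h : p ≤ p') (hℓ : 0 < ℓ) (L : ℝ)
    (X : Config (k + 1)) : treeWeight p ℓ L X ≤ treeWeight p' ℓ L X := by
  unfold treeWeight
  refine Finset.prod_le_prod (fun j _ => ?_) fun j _ => ?_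
  · exact Real.rpow_nonneg (add_nonneg zero_le_one (div_nonneg (treeDist_nonneg L X j) hℓ.le)) _
  · exact Real.rpow_le_rpow_of_exponent_le
      (le_add_of_nonneg_right (div_nonneg (treeDist_nonneg L X j) hℓ.le)) h

end Weights

/-! ### Weighted sup norms of one kernel -/

section WeightedSup

variable {k : ℕ} {E : Type*} [SeminormedAddCommGroup E]

/-- The POWER-WEIGHTED SUP NORM `sup_{x₀} sup_{x₁ … x_k} treeWeight(X) · |f(X)| ∈ [0, ∞]` of one
kernel of arity `k + 1` (sup over all of `(ℝ³)^{k+1}`). [folklore] -/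
def weightedSup (p ℓ L : ℝ) (f : Config (k + 1) → E) : ℝ≥0∞ :=
  ⨆ X, ENNReal.ofReal (treeWeight p ℓ L X) * ‖f X‖₊

/-- Each weighted value is below the weighted sup. [folklore] -/
theorem weighted_le_weightedSup (p ℓ L : ℝ) (f : Config (k + 1) → E) (X : Config (k + 1)) :
    ENNReal.ofReal (treeWeight p ℓ L X) * ‖f X‖₊ ≤ weightedSup p ℓ L f :=
  le_iSup (fun X => ENNReal.ofReal (treeWeight p ℓ L X) * (‖f X‖₊ : ℝ≥0∞)) X

/-- The weighted sup norm is bounded by `C` as soon as every weighted value is. [folklore] -/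
theorem weightedSup_le {p ℓ L : ℝ} {f : Config (k + 1) → E} {C : ℝ≥0∞}
    (h : ∀ X, ENNReal.ofReal (treeWeight p ℓ L X) * ‖f X‖₊ ≤ C) : weightedSup p ℓ L f ≤ C :=
  iSup_le h

/-- The weighted sup norm dominates the plain sup norm (`0 ≤ p`, `0 < ℓ`). [folklore] -/
theorem nnnorm_le_weightedSup {p ℓ : ℝ} (hp : 0 ≤ p) (hℓ : 0 < ℓ) (L : ℝ) (f : Config (k + 1) → E)
    (X : Config (k + 1)) : (‖f X‖₊ : ℝ≥0∞) ≤ weightedSup p ℓ L f := by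
  calc (‖f X‖₊ : ℝ≥0∞) = 1 * ‖f X‖₊ := (one_mul _).symm
    _ ≤ ENNReal.ofReal (treeWeight p ℓ L X) * ‖f X‖₊ := by
      refine mul_le_mul_left ?_ _
      rw [← ENNReal.ofReal_one]
      exact ENNReal.ofReal_le_ofReal (one_le_treeWeight hp hℓ L X)
    _ ≤ weightedSup p ℓ L f := weighted_le_weightedSup p ℓ L f X

/-- The zero kernel has weighted sup norm `0`. [folklore] -/
@[simp] theorem weightedSup_zero (p ℓ L : ℝ) :
    weightedSup p ℓ L (0 : Config (k + 1) → E) = 0 := by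
  simp [weightedSup]

/-- The weighted sup norm decreases as the locality scale grows (`0 ≤ p`, `0 < ℓ ≤ ℓ'`).
[folklore] -/
theorem weightedSup_anti_scale {p ℓ ℓ' : ℝ} (hp : 0 ≤ p) (hℓ : 0 < ℓ) (h : ℓ ≤ ℓ') (L : ℝ)
    (f : Config (k + 1) → E) : weightedSup p ℓ' L f ≤ weightedSup p ℓ L f :=
  iSup_mono fun X =>
    mul_le_mul_left (ENNReal.ofReal_le_ofReal (treeWeight_anti_scale hp hℓ h L X)) _

/-- The weighted sup norm increases with the decay exponent (`p ≤ p'`, `0 < ℓ`). [folklore] -/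
theorem weightedSup_mono_exponent {p p' ℓ : ℝ} (h : p ≤ p') (hℓ : 0 < ℓ) (L : ℝ)
    (f : Config (k + 1) → E) : weightedSup p ℓ L f ≤ weightedSup p' ℓ L f :=
  iSup_mono fun X =>
    mul_le_mul_left (ENNReal.ofReal_le_ofReal (treeWeight_mono_exponent h hℓ L X)) _

end WeightedSup

/-! ### The graded kernel norms -/

section KernelNorm

variable {E : ℕ → Type*} [∀ k, SeminormedAddCommGroup (E k)]

/-- The LOCALITY-GRADED, POWER-WEIGHTED KERNEL NORM of a family of many-body kernels on the
torus of side `L`, with decay exponent `p`, activity `z` and locality scale `ℓ`: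
`‖u‖_{p,z,ℓ} = ∑_{k ≥ 0} z^k · sup_X (∏_{j=1}^{k} (1 + treeDist_j(X)/ℓ)^p) |u_k(X)| ∈ [0, ∞]`
(the kernel `u k` has arity `k + 1`, so the activity weight is `z^{arity - 1}`). [folklore] -/
def kernelNorm (L p : ℝ) (z : ℝ≥0) (ℓ : ℝ) (u : (k : ℕ) → Config (k + 1) → E k) : ℝ≥0∞ :=
  ∑' k, (z : ℝ≥0∞) ^ k * weightedSup p ℓ L (u k)

/-- Each arity contributes at most the whole norm. [folklore] -/
theorem weightedSup_le_kernelNorm (L p : ℝ) (z : ℝ≥0) (ℓ : ℝ) (u : (k : ℕ) → Config (k + 1) → E k)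
    (k : ℕ) : (z : ℝ≥0∞) ^ k * weightedSup p ℓ L (u k) ≤ kernelNorm L p z ℓ u :=
  ENNReal.le_tsum (f := fun k => (z : ℝ≥0∞) ^ k * weightedSup p ℓ L (u k)) k

/-- Pointwise bound: `z^k |u_k(X)| ≤ ‖u‖_{p,z,ℓ}` (`0 ≤ p`, `0 < ℓ`). [folklore] -/
theorem nnnorm_le_kernelNorm {p ℓ : ℝ} (hp : 0 ≤ p) (hℓ : 0 < ℓ) (L : ℝ) (z : ℝ≥0)
    (u : (k : ℕ) → Config (k + 1) → E k) (k : ℕ) (X : Config (k + 1)) :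
    (z : ℝ≥0∞) ^ k * ‖u k X‖₊ ≤ kernelNorm L p z ℓ u :=
  (mul_le_mul_right (nnnorm_le_weightedSup hp hℓ L (u k) X) _).trans
    (weightedSup_le_kernelNorm L p z ℓ u k)

/-- The zero family has norm `0`. [folklore] -/
@[simp] theorem kernelNorm_zero (L p : ℝ) (z : ℝ≥0) (ℓ : ℝ) :
    kernelNorm L p z ℓ (0 : (k : ℕ) → Config (k + 1) → E k) = 0 := by
  simp [kernelNorm]

/-- GRADING: the kernel norms decrease as the locality scale grows,
`‖u‖_{p,z,ℓ'} ≤ ‖u‖_{p,z,ℓ}` for `0 < ℓ ≤ ℓ'` (`0 ≤ p`). [folklore] -/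
theorem kernelNorm_anti_scale {p ℓ ℓ' : ℝ} (hp : 0 ≤ p) (hℓ : 0 < ℓ) (h : ℓ ≤ ℓ') (L : ℝ) (z : ℝ≥0)
    (u : (k : ℕ) → Config (k + 1) → E k) : kernelNorm L p z ℓ' u ≤ kernelNorm L p z ℓ u :=
  ENNReal.tsum_le_tsum fun k => mul_le_mul_right (weightedSup_anti_scale hp hℓ h L (u k)) _

/-- The kernel norms increase with the decay exponent (`p ≤ p'`, `0 < ℓ`). [folklore] -/
theorem kernelNorm_mono_exponent {p p' ℓ : ℝ} (h : p ≤ p') (hℓ : 0 < ℓ) (L : ℝ) (z : ℝ≥0)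
    (u : (k : ℕ) → Config (k + 1) → E k) : kernelNorm L p z ℓ u ≤ kernelNorm L p' z ℓ u :=
  ENNReal.tsum_le_tsum fun k => mul_le_mul_right (weightedSup_mono_exponent h hℓ L (u k)) _

end KernelNorm

/-- The GRADIENT KERNEL NORM `‖∇u‖_{p,z,ℓ}`: the kernel norm of the family of total derivatives
`X ↦ D(u_k)(X) ∈ (Config (k+1) →L[ℝ] ℝ)` in the operator norm (for the sup norm on
`(ℝ³)^{k+1}` this is `∑_j |∇_{x_j} u_k(X)|`; `fderiv = 0` off the differentiability set).
[folklore] -/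
def gradKernelNorm (L p : ℝ) (z : ℝ≥0) (ℓ : ℝ) (u : (k : ℕ) → Config (k + 1) → ℝ) : ℝ≥0∞ :=
  kernelNorm L p z ℓ fun k X => fderiv ℝ (u k) X

/-- The zero family has gradient norm `0`. [folklore] -/
@[simp] theorem gradKernelNorm_zero (L p : ℝ) (z : ℝ≥0) (ℓ : ℝ) :
    gradKernelNorm L p z ℓ (0 : (k : ℕ) → Config (k + 1) → ℝ) = 0 := by
  have h : (fun (k : ℕ) (X : Config (k + 1)) => fderiv ℝ ((0 : (k : ℕ) → Config (k + 1) → ℝ) k) X)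
      = 0 := by
    funext k X
    rw [Pi.zero_apply, fderiv_zero]
    rfl
  unfold gradKernelNorm
  rw [h]
  exact kernelNorm_zero L p z ℓ

/-- The gradient norm is graded like the norm (`0 ≤ p`, `0 < ℓ ≤ ℓ'`). [folklore] -/
theorem gradKernelNorm_anti_scale {p ℓ ℓ' : ℝ} (hp : 0 ≤ p) (hℓ : 0 < ℓ) (h : ℓ ≤ ℓ') (L : ℝ)
    (z : ℝ≥0) (u : (k : ℕ) → Config (k + 1) → ℝ) :
    gradKernelNorm L p z ℓ' u ≤ gradKernelNorm L p z ℓ u :=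
  kernelNorm_anti_scale hp hℓ h L z _

end Literature.MathematicalPhysics.QuantumManyBody.BoseGas
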